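import Summits.BirchSwinnertonDyer.BirchSwinnertonDyer.Theorems.SignedLowerHalvesSmallImageMuZeroOneSignFinePivotOneSign
import Summits.BirchSwinnertonDyer.Rank1Residual.GaloisImage.NonsplitCartanDictionary
import HarnessLib

/-!
# Route `SignedLowerHalves` (K3), crux M `SmallImageMuZeroOneSign` (item stmt-BirchSwinnertonDyer-23600), line `birth_mu` v3 —
# the OPEN stub `stub_conjA_ns_ge5` (Conjecture A on the class, `p ≥ 5`) ⟺ its `p ∈ {5, 7, 11}` cut, PRINT-FREE modulo
# BDMTV 2019/2023 (published) and the non-split half of Serre uniformity at `p ≥ 19` (open)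

LEAD seat `cruxlead-stmt-BirchSwinnertonDyer-23600` gen 3 (cell `bsd-ssimc`; `--supports stmt-BirchSwinnertonDyer-23600`, helper).
HONEST FRAMING: THEOREMS ONLY (no definition, no named fact, no instance, no `sorry`); CONDITIONAL theorems with their binders
displayed (`h13` = `BDMTV2019_nonsplitCartan_level13`, `h17` = `BDMTV2023_nonsplitCartan_level17` — PUBLISHED named facts, no
`_holds`; `h19` = `NonsplitCartanPointsAreCM q` for every prime `q ≥ 19` — OPEN, expected; the printed binders of the lead's
files where M is concluded).  Crux M, crux 4, Conjecture A and BSD are NOT proved; nothing is booked.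

WHAT.  Line `birth_mu` v3 (registered 2026-08-29T03:13:20Z, sha16 97423e673ecfb888) has ONE open stub,
`stub_conjA_ns_ge5 : ∀ W p, 5 ≤ p → ClassX7 W p → ¬ W.HasCM → W.frobeniusTrace p = 0 → ¬ Surj W p → ConjAAt W p`
(Coates–Sujatha Conjecture A on the small-image supersingular X7 class).  Width -w3 g2 proved the analogous localisation for the
v2 stub (= retired 23117; `SmallImageMuAnEvenBranch.stub_iff_le_eleven`, p688190): at `p = 13, 17` (BDMTV) and at every `p ≥ 19`
(non-split Serre uniformity) the DOMAIN IS EMPTY — route-independent kernel `GaloisImage.hasNonsplitCartanModPImage_of_goodSS_of_not_surj`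
(good supersingular + not onto ⟹ image in `N(C_ns(p))` ⟹ CM by `hU` ⟹ contradiction with `¬CM`).  This file records the same
for the v3 stub, on its TEXT (left side = the registered signature verbatim):

* `conjA_ns_ge5_iff_le_eleven` — **the stub ⟺ its `5 ≤ p ≤ 11` cut** modulo `h13`, `h17`, `h19`; PRINT-FREE otherwise.
* `conjA_ns_ge5_of_cut` — the ← direction alone (the shape a closer consumes).
* `smallImageMuZeroOneSign_of_facts_of_conjA_cut_le_eleven` — **crux M BY NAME ⟸ the eight printed binders ∧ `h13` ∧ `h17` ∧ `h19`
  ∧ Conjecture A on the class at `p ∈ {5, 7, 11}` only** (composition with the lead's `smallImageMuZeroOneSign_of_facts_of_conjA_ge_five`).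
READING FOR THE PEN (D-0014; numbers): granted BDMTV (published) and non-split Serre uniformity (open), the open content of crux M is
«Conjecture A (μ-form) for the non-CM ℚ-points of `X_ns⁺(5)`, `X_ns⁺(7)`, `X_ns⁺(11)` with an additive prime» — three infinite
families (genus 0, 0, 1); per pair decidable by ONE class number (`SmallImageCleanAtP.oneSignMuZero_of_not_dvd_classNumber_stabilizerField`).

References: [BalakrishnanEtAl2019] Cor. 1.3; [BalakrishnanEtAl2023] Thm. 1.2; [SerreKyoto1977] questions 6.5–6.6; [Serre1972] §1.11
Prop. 12, §2.2 Prop. 14, §2.7 Prop. 17; [CoatesSujatha2005] §3 Conjecture A; [Balakrishnan2026ICM] Problem 6.1.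
-/

set_option autoImplicit false
set_option linter.dupNamespace false

noncomputable section

open scoped Classical

open WeierstrassCurve Literature.NumberTheory.EllipticCurves Literature.NumberTheory.EllipticCurves.Rank1Residual
  Literature.NumberTheory.EllipticCurves.Kobayashi2003 Literature.NumberTheory.EllipticCurves.ModularForms
  Literature.NumberTheory.SerreUniformity

namespace Summit.BirchSwinnertonDyer.BirchSwinnertonDyer.Theorems.SmallImageConjACut

/-- **The domain of the stub is EMPTY at a prime `p` with `X_ns⁺(p)(ℚ)` CM**: `NonsplitCartanPointsAreCM p`, `p ≠ 2`, `ClassX7 W p`,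
`¬ Surj W p` ⟹ `W` has CM (route-independent kernel `GaloisImage.hasNonsplitCartanModPImage_of_goodSS_of_not_surj`), contradicting
`¬ W.HasCM`. [cite: Serre1972, §1.11 Prop. 12, §2.7 Prop. 17] [cite: SerreKyoto1977, questions 6.5–6.6, pp. 187–188] -/
theorem domain_empty_of_nonsplitCartanPointsAreCM (W : WeierstrassCurve ℚ) [W.IsElliptic] [W.IsGloballyMinimal] (p : ℕ)
    [Fact p.Prime] (hU : NonsplitCartanPointsAreCM p) (hp2 : p ≠ 2) (hX : ClassX7 W p) (hCM : ¬ W.HasCM) (hs : ¬ Surj W p) :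
    False :=
  hCM (hU W (Summit.BirchSwinnertonDyer.Rank1Residual.GaloisImage.hasNonsplitCartanModPImage_of_goodSS_of_not_surj W p hp2 hX.1 hs))

/-- **The registered open stub `stub_conjA_ns_ge5` of line `birth_mu` v3 (VERBATIM text) ⟺ its `p ≤ 11` cut**, GRANTED BDMTV 2019
Cor. 1.3 / 2023 Thm. 1.2 (`h13`, `h17`: the `ℚ`-points of `X_ns⁺(13)`, `X_ns⁺(17)` are CM — PUBLISHED, by name) and the non-split half
of Serre's uniformity question at every prime `p ≥ 19` (`h19`, OPEN, expected).  PRINT-FREE otherwise: at `13`, `17` and `≥ 19` the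
stub's domain is EMPTY (`domain_empty_of_nonsplitCartanPointsAreCM`).  So modulo BDMTV and Serre uniformity the open stub is EXACTLY
«Conjecture A at every small-image X7 pair with `p ∈ {5, 7, 11}`» (non-CM `ℚ`-points of `X_ns⁺(5)`, `X_ns⁺(7)`, `X_ns⁺(11)` with an
additive prime: infinite families).  Closes nothing. [cite: BalakrishnanEtAl2019, Cor. 1.3] [cite: BalakrishnanEtAl2023, Thm. 1.2]
[cite: SerreKyoto1977, questions 6.5–6.6, pp. 187–188] [cite: CoatesSujatha2005, §3 Conjecture A] -/
theorem conjA_ns_ge5_iff_le_eleven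
    (h13 : BDMTV2019_nonsplitCartan_level13) (h17 : BDMTV2023_nonsplitCartan_level17)
    (h19 : ∀ (q : ℕ), q.Prime → 19 ≤ q → NonsplitCartanPointsAreCM q) :
    (∀ (W : WeierstrassCurve ℚ) [W.IsElliptic] [W.IsGloballyMinimal] (p : ℕ) [Fact p.Prime],
        5 ≤ p → ClassX7 W p → ¬ W.HasCM → W.frobeniusTrace p = 0 → ¬ Surj W p → ConjAAt W p) ↔
      ∀ (W : WeierstrassCurve ℚ) [W.IsElliptic] [W.IsGloballyMinimal] (p : ℕ) [Fact p.Prime],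
        5 ≤ p → p ≤ 11 → ClassX7 W p → ¬ W.HasCM → W.frobeniusTrace p = 0 → ¬ Surj W p → ConjAAt W p := by
  constructor
  · intro h W _ _ p _ hp5 _ hX hCM hap hs
    exact h W p hp5 hX hCM hap hs
  · intro h5711 W _ _ p hpP hp5 hX hCM hap hs
    have hpr : p.Prime := hpP.out
    have hp2 : p ≠ 2 := by omega
    by_cases h11 : p ≤ 11
    · exact h5711 W p hp5 h11 hX hCM hap hs
    -- `12 ≤ p`: the domain is EMPTY once `X_ns⁺(p)(ℚ)` is CM
    have hempty : NonsplitCartanPointsAreCM p → False := fun hU ↦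
      domain_empty_of_nonsplitCartanPointsAreCM W p hU hp2 hX hCM hs
    by_cases h19p : 19 ≤ p
    · exact (hempty (h19 p hpr h19p)).elim
    · have h1317 : p = 13 ∨ p = 17 := by
        interval_cases p <;> first | (left; rfl) | (right; rfl) | exact absurd hpr (by decide)
      rcases h1317 with rfl | rfl
      · exact (hempty h13).elim
      · exact (hempty h17).elim

/-- **The stub from its cut** (← of `conjA_ns_ge5_iff_le_eleven`; the shape a closer consumes as the `hA5` binder of
`SmallImageFinePivot.smallImageMuZeroOneSign_of_facts_of_conjA_ge_five`). [cite: BalakrishnanEtAl2019, Cor. 1.3]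
[cite: BalakrishnanEtAl2023, Thm. 1.2] [cite: CoatesSujatha2005, §3 Conjecture A] -/
theorem conjA_ns_ge5_of_cut
    (h13 : BDMTV2019_nonsplitCartan_level13) (h17 : BDMTV2023_nonsplitCartan_level17)
    (h19 : ∀ (q : ℕ), q.Prime → 19 ≤ q → NonsplitCartanPointsAreCM q)
    (h5711 : ∀ (W : WeierstrassCurve ℚ) [W.IsElliptic] [W.IsGloballyMinimal] (p : ℕ) [Fact p.Prime],
        5 ≤ p → p ≤ 11 → ClassX7 W p → ¬ W.HasCM → W.frobeniusTrace p = 0 → ¬ Surj W p → ConjAAt W p) :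
    ∀ (W : WeierstrassCurve ℚ) [W.IsElliptic] [W.IsGloballyMinimal] (p : ℕ) [Fact p.Prime],
        5 ≤ p → ClassX7 W p → ¬ W.HasCM → W.frobeniusTrace p = 0 → ¬ Surj W p → ConjAAt W p :=
  (conjA_ns_ge5_iff_le_eleven h13 h17 h19).mpr h5711

/-- **CRUX M `SmallImageMuZeroOneSign` BY NAME ⟸ the eight printed binders ∧ BDMTV 13/17 ∧ non-split Serre uniformity `≥ 19` ∧
Conjecture A on the class at `p ∈ {5, 7, 11}` ONLY** — line `birth_mu` v3's composition (`smallImageMuZeroOneSign_of_facts_of_conjA_ge_five`: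
`p = 3` rows by print alone, `p ≥ 5` rows by Conjecture A) with its open stub cut down by `conjA_ns_ge5_of_cut`.  CONDITIONAL;
closes nothing. [cite: CoatesSujatha2005, §3 Conjecture A] [cite: Kobayashi2003, Thm. 1.2, Thm. 6.2–6.3, Thm. 7.3]
[cite: BalakrishnanEtAl2019, Cor. 1.3] [cite: BalakrishnanEtAl2023, Thm. 1.2] [cite: KuriharaPollack2007, §1.2, §3 p. 328] [cite: Matar2020, Thm. 1.1] -/
theorem smallImageMuZeroOneSign_of_facts_of_conjA_cut_le_eleven
    (hCK : thm62_63_73_signedColemanKato_zeta) (h12 : thm12_signedSelmerDual_finite_torsion)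
    (h5 : realPeriodRat_eq_unit_mul_plusPeriod) (h3 : realPeriodRat_eq_unit_mul_plusPeriod_three)
    (hmodP : nonempty_modularParametrizationData)
    (hKP : kuriharaPollack2007_selmerDual_extension_of_fineDual)
    (hKo : signedSelmerInf_sub_fineSelmer_of_loc)
    (hMa : matar2020_thm11_selmerDualTorsion_pseudoIso_fineSelmerDual)
    (h13 : BDMTV2019_nonsplitCartan_level13) (h17 : BDMTV2023_nonsplitCartan_level17)
    (h19 : ∀ (q : ℕ), q.Prime → 19 ≤ q → NonsplitCartanPointsAreCM q)
    (h5711 : ∀ (W : WeierstrassCurve ℚ) [W.IsElliptic] [W.IsGloballyMinimal] (p : ℕ) [Fact p.Prime],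
        5 ≤ p → p ≤ 11 → ClassX7 W p → ¬ W.HasCM → W.frobeniusTrace p = 0 → ¬ Surj W p → ConjAAt W p) :
    Summit.BirchSwinnertonDyer.BirchSwinnertonDyer.Theses.SignedLowerHalves.SmallImageMuZeroOneSign :=
  SmallImageFinePivot.smallImageMuZeroOneSign_of_facts_of_conjA_ge_five hCK h12 h5 h3 hmodP hKP hKo hMa
    (conjA_ns_ge5_of_cut h13 h17 h19 h5711)

end Summit.BirchSwinnertonDyer.BirchSwinnertonDyer.Theorems.SmallImageConjACut

end
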